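import Summits.ResolutionOfSingularities.ResolutionOfSingularities.Theorems.FrobeniusLadderFInjectiveMacaulayficationFHalfRowOfTwoStoreysChartModel
import Summits.ResolutionOfSingularities.ResolutionOfSingularities.Theorems.FrobeniusLadderFInjectiveMacaulayficationFDStorey2ChartIso
import Summits.ResolutionOfSingularities.ResolutionOfSingularities.Theorems.FrobeniusLadderFInjectiveMacaulayficationFDStorey2Specimen
import Summits.ResolutionOfSingularities.ResolutionOfSingularities.Theorems.FrobeniusLadderFInjectiveMacaulayficationFDStorey1PolyTables
import Mathlib.RingTheory.Jacobson.Ring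
import HarnessLib

/-!
# (W-TD/W8) ROW #8 ASSEMBLY MODULO ITS TWO DATA MODULES: BED D = storey 1 `Bl_{𝔪·K} X_D` FULL off the point `P` of chart 277 + a LOCAL storey 2 at `P` with an `𝔪_P`-primary centre
# (crux `FInjectiveMacaulayfication` stmt-ResolutionOfSingularities-15315, chain w45a; res-L1-w45a-plan-1 RULING R21.34 «ROW #8 ROUTE OF RECORD = (W8): LOCAL SECOND STOREY, ✓p664558 … the
# assembly is ✓p664558 over (a) stub-2ʼs `storey1_fullCl_off_P(_mul)`, (b) stub-3ʼs `…FDStorey2L1BlowupFull` on Spec k[Y]/(G) at the origin, (c) the coordinate iso + transport along ι»;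
# seat res-L1-w45a-stub-1 g13. THIS FILE: the assembly with (a) and (b) as HYPOTHESES in their announced letters — the row file `…FDTwoStoreyRow` is then one `obtain` + one `exact`.)

[OURS · L1 W4.5a] Support file (`--supports stmt-ResolutionOfSingularities-15315 --as helper`); def-free; UNCONDITIONAL (the two data modules enter as explicit hypotheses, not as
named facts); NOT a statement of any manuscript. Nothing of the crux is proved. AI-written (AI review is weaker than expert review).

`f_D = X4⁴ + X0⁵X4 + X0⁶ + X1³ + X2³ + X3⁷` (x,y,u,t,z = X0..X4), `char k = 2`, `X = Spec k[X]/(f_D)`, `v` the vertex, `𝔪 = (x̄ⱼ)`; storey 1 = `affineBlowup (𝔪 * K₁)` for ANY `K₁ ≠ ⊥` with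
`𝔪 ⊆ √K₁` (stub-2ʼs `K = span x̄^{genSet 5 KL2}`), together with an open immersion `ι : Spec k[Y]/(g₂₇₇) → affineBlowup (𝔪 * K₁)` compatible with the chart map `θ₂₇₇ : Xⱼ ↦ ∏ᵢ Yᵢ^{Vq 277 i j}`
and FULL off `ι P₀`, `P₀ = 𝔪̄_P = (Y₀,Y₁,Y₂+1,Y₃,Y₄)` (= the letter of `FDStorey1BlowupFull.storey1_fullCl_off_P_mul`); storey 2 = an ideal `I ≠ ⊥` of `k[Y]/(G)` (`G` = ✓ `FDStorey2Specimen`ʼs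
translated equation) with `(Ȳⱼ) ⊆ √I` and `affineBlowup I` FULL at every point (= the letter asked of `…FDStorey2L1BlowupFull`).
* `Vq277_row_three_pos` (table reading: every `θ₂₇₇(Xⱼ)` is divisible by `Y₃`), `theta277_X_mem_span_HS`, `comap_span_HS` (`θ₂₇₇⁻¹(𝔪̄_P) = (X₀,…,X₄)`: the point `P` lies over `v`).
* ★★★ `twoStorey_fD_row_of` — for EVERY blowing up `g : S′ → Spec 𝒪_{X,v}` along the point floor `𝔪·𝒪`: `∃ 𝓚 ≠ ⊥` on `S′` supported over the closed point, ALL of whose blowings up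
  are FULL (`FullCl 2`) at every stalk. Route: `P := ι P₀` is closed (Jacobson) and over `v` (`comap_span_HS`); the storey-2 datum at `P` by ✓ `localSecondStorey_of_chartModel` through
  ✓ `FDStorey2ChartIso.exists_chartEquiv`; then ✓ `fHalfConclusion_of_localSecondStorey_affine`.
[cite: Temkin2008, Lemma 2.1.1 and Lemma 2.1.4] [cite: StacksProject, Tag 080B and Tag 0804] [cite: GortzWedhorn2020, Prop. 13.91 and (13.19)]
-/

-- single-problem summit: the doubled namespace component is forced
set_option linter.dupNamespace false

noncomputable section

open AlgebraicGeometry CategoryTheory Literature.AlgebraicGeometry.Resolution TopologicalSpace IsLocalRing MvPolynomial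

namespace Summit.ResolutionOfSingularities.ResolutionOfSingularities.Theorems.FInjectiveMacaulayfication.FDTwoStoreyRow

open Summit.ResolutionOfSingularities.ResolutionOfSingularities.Theorems.FInjectiveMacaulayfication
open SliceableCentre FDStorey1Fan FDStorey1PIdeal FHalfRowOfTwoStoreys

variable (k : Type) [Field k]

/-! ## §1 The point `P` of chart 277 lies over the vertex: `θ₂₇₇⁻¹(𝔪_P) = (X₀, …, X₄)` -/

/-- Table reading: row `3` of `Vq 277` is positive — every `θ₂₇₇(Xⱼ) = ∏ᵢ Yᵢ^{Vq 277 i j}` is divisible by `Y₃`. [generated-table reading] -/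
theorem Vq277_row_three_pos : ∀ j : Fin 5, 0 < Vq (277 : Fin 327) 3 j := by
  decide +kernel

/-- `θ₂₇₇(Xⱼ) ∈ 𝔪_P = (Y₀, Y₁, Y₂+1, Y₃, Y₄)` for every `j` (it is a multiple of `Y₃`). [certificate reading] -/
theorem theta277_X_mem_span_HS (j : Fin 5) :
    aeval (fun j : Fin 5 => ∏ i : Fin 5, (X i : MvPolynomial (Fin 5) k) ^ Vq (277 : Fin 327) i j) (X j : MvPolynomial (Fin 5) k) ∈
      Ideal.span {x | x ∈ HS.map (KLocCellKit.evalL k)} := by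
  rw [aeval_X]
  have h3 : (X 3 : MvPolynomial (Fin 5) k) ∈ Ideal.span {x | x ∈ HS.map (KLocCellKit.evalL k)} := by
    rw [HS_map_evalL]
    exact Ideal.subset_span (by simp)
  have hdvd : (X 3 : MvPolynomial (Fin 5) k) ∣ ∏ i : Fin 5, (X i : MvPolynomial (Fin 5) k) ^ Vq (277 : Fin 327) i j := by
    have h1 : (X 3 : MvPolynomial (Fin 5) k) ∣ (X 3 : MvPolynomial (Fin 5) k) ^ Vq (277 : Fin 327) 3 j :=
      dvd_pow_self _ (Vq277_row_three_pos j).ne'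
    exact h1.trans (Finset.dvd_prod_of_mem (fun i : Fin 5 => (X i : MvPolynomial (Fin 5) k) ^ Vq (277 : Fin 327) i j) (Finset.mem_univ (3 : Fin 5)))
  exact Ideal.mem_of_dvd _ hdvd h3

/-- ★ **`θ₂₇₇⁻¹(𝔪̄_P) = (X₀, …, X₄)`**: the pull-back to `k[X]` of the point ideal `𝔪̄_P ⊆ k[Y]/(g₂₇₇)` along `mk ∘ θ₂₇₇` is the origin ideal. [folklore] -/
theorem comap_span_HS [CharP k 2] :
    (((Ideal.span {x | x ∈ HS.map (KLocCellKit.evalL k)}).map (Ideal.Quotient.mk (Ideal.span {KLocCellKit.evalL k (G (277 : Fin 327))}))).comap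
        ((Ideal.Quotient.mk (Ideal.span {KLocCellKit.evalL k (G (277 : Fin 327))})).comp
          (aeval (fun j : Fin 5 => ∏ i : Fin 5, (X i : MvPolynomial (Fin 5) k) ^ Vq (277 : Fin 327) i j)).toRingHom)) =
      MvPolynomial.idealOfVars (Fin 5) k := by
  haveI hmax : ((Ideal.span {x | x ∈ HS.map (KLocCellKit.evalL k)}).map
      (Ideal.Quotient.mk (Ideal.span {KLocCellKit.evalL k (G (277 : Fin 327))}))).IsMaximal := by
    haveI := isMaximal_span_HS k
    refine Ideal.IsMaximal.map_of_surjective_of_ker_le Ideal.Quotient.mk_surjective ?_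
    rw [Ideal.mk_ker, Ideal.span_le, Set.singleton_subset_iff]
    exact evalL_G_mem_span_HS k 277 (Or.inr rfl)
  haveI hprime := hmax.isPrime
  symm
  refine (QuotientOriginMaximal.idealOfVars_isMaximal k (n := 5)).eq_of_le (Ideal.comap_isPrime _ _).ne_top ?_
  rw [MvPolynomial.idealOfVars, Ideal.span_le]
  rintro _ ⟨j, rfl⟩
  rw [SetLike.mem_coe, Ideal.mem_comap, RingHom.comp_apply]
  exact Ideal.mem_map_of_mem _ (theta277_X_mem_span_HS k j)

/-! ## §2 ★★★ The row modulo its two data modules -/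

set_option maxHeartbeats 800000 in
-- large statement; several instance constructions on quotient rings
/-- ★★★ **BED D, TWO STOREYS, ASSEMBLED (modulo the storey-1 and storey-2 modules).** See the module docstring for the letters of the hypotheses. [OURS · assembly]
[cite: Temkin2008, Lemma 2.1.4] [cite: StacksProject, Tag 080B] [cite: GortzWedhorn2020, Prop. 13.91] -/
theorem twoStorey_fD_row_of [CharP k 2] (f : MvPolynomial (Fin 5) k) (hf : f = X 4 ^ 4 + X 0 ^ 5 * X 4 + X 0 ^ 6 + X 1 ^ 3 + X 2 ^ 3 + X 3 ^ 7)
    (𝔪 : Ideal (MvPolynomial (Fin 5) k ⧸ Ideal.span {f})) (h𝔪 : 𝔪 = Ideal.span (Set.range (fun j : Fin 5 => Ideal.Quotient.mk (Ideal.span {f}) (X j))))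
    (v : Spec (.of (MvPolynomial (Fin 5) k ⧸ Ideal.span {f}))) (hv : v.asIdeal = 𝔪)
    -- storey 1 (res-L1-w45a-stub-2ʼs `storey1_fullCl_off_P_mul`, with `K₁ = span x̄^{genSet 5 KL2}`)
    (K₁ : Ideal (MvPolynomial (Fin 5) k ⧸ Ideal.span {f})) (hK₁ : K₁ ≠ ⊥)
    (h𝔪K₁ : 𝔪 ≤ K₁.radical)
    (ι : Spec (.of (MvPolynomial (Fin 5) k ⧸ Ideal.span {KLocCellKit.evalL k (G (277 : Fin 327))})) ⟶
      affineBlowup (𝔪 * K₁))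
    [IsOpenImmersion ι]
    (hcompat : ∀ q : Spec (.of (MvPolynomial (Fin 5) k ⧸ Ideal.span {KLocCellKit.evalL k (G (277 : Fin 327))})),
      ((affineBlowup.π _).base (ι.base q)).asIdeal.comap (Ideal.Quotient.mk (Ideal.span {f})) =
        q.asIdeal.comap ((Ideal.Quotient.mk (Ideal.span {KLocCellKit.evalL k (G (277 : Fin 327))})).comp
          (aeval (fun j : Fin 5 => ∏ i : Fin 5, (X i : MvPolynomial (Fin 5) k) ^ Vq (277 : Fin 327) i j)).toRingHom))
    (hoff : ∀ P₀ : Spec (.of (MvPolynomial (Fin 5) k ⧸ Ideal.span {KLocCellKit.evalL k (G (277 : Fin 327))})),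
      P₀.asIdeal = (Ideal.span {x | x ∈ HS.map (KLocCellKit.evalL k)}).map (Ideal.Quotient.mk (Ideal.span {KLocCellKit.evalL k (G (277 : Fin 327))})) →
      ∀ y : ↥(affineBlowup (𝔪 * K₁)),
        y ≠ ι.base P₀ → FullCl 2 ((affineBlowup (𝔪 * K₁)).presheaf.stalk y))
    -- storey 2 (res-L1-w45a-stub-3ʼs `…FDStorey2L1BlowupFull`, local, `𝔪_P`-primary)
    (G₃ : MvPolynomial (Fin 5) k) (hG₃ : G₃ = X 2 ^ 2 + X 0 ^ 3 + X 1 ^ 3 + X 3 * X 4 ^ 4 + X 3 ^ 2 * X 4 + X 2 * X 3 * X 4 ^ 4 + X 2 * X 3 ^ 2 * X 4)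
    (I : Ideal (MvPolynomial (Fin 5) k ⧸ Ideal.span {G₃})) (hI : I ≠ ⊥)
    (hIQ : Ideal.span (Set.range (fun j : Fin 5 => Ideal.Quotient.mk (Ideal.span {G₃}) (X j))) ≤ I.radical)
    (hfull : ∀ y : ↥(affineBlowup I), FullCl 2 ((affineBlowup I).presheaf.stalk y)) :
    ∀ (S' : Scheme.{0}) (g : S' ⟶ Spec ((Spec (.of (MvPolynomial (Fin 5) k ⧸ Ideal.span {f}))).presheaf.stalk v)),
      IsBlowup g ((affineBlowup.idealSheaf 𝔪).comap
        ((Spec (.of (MvPolynomial (Fin 5) k ⧸ Ideal.span {f}))).fromSpecStalk v)) →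
      ∃ 𝓚 : S'.IdealSheafData, 𝓚 ≠ ⊥ ∧
        (∀ s ∈ (𝓚.support : Set S'), g.base s = closedPoint ((Spec (.of (MvPolynomial (Fin 5) k ⧸ Ideal.span {f}))).presheaf.stalk v)) ∧
        ∀ (S'' : Scheme.{0}) (π : S'' ⟶ S'), IsBlowup π 𝓚 → ∀ s : S'', FullCl 2 (S''.presheaf.stalk s) := by
  classical
  -- the base ring `A₀ = k[X]/(f)` is a Noetherian domain
  haveI hp : (Ideal.span {f}).IsPrime := FDSpecimen.isPrime_span_f k f hf
  haveI : IsDomain (MvPolynomial (Fin 5) k ⧸ Ideal.span {f}) := Ideal.Quotient.isDomain _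
  have h𝔪ne : 𝔪 ≠ ⊥ := by
    intro h0
    have hmem : Ideal.Quotient.mk (Ideal.span {f}) (X 0) ∈ 𝔪 := by rw [h𝔪]; exact Ideal.subset_span ⟨0, rfl⟩
    rw [h0, Ideal.mem_bot] at hmem
    exact FDSpecimen.mk_X_ne_zero k f hf 0 hmem
  -- the point `P₀ = 𝔪̄_P` of the chart and `P := ι P₀`
  have hmax : ((Ideal.span {x | x ∈ HS.map (KLocCellKit.evalL k)}).map
      (Ideal.Quotient.mk (Ideal.span {KLocCellKit.evalL k (G (277 : Fin 327))}))).IsMaximal := by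
    haveI := isMaximal_span_HS k
    refine Ideal.IsMaximal.map_of_surjective_of_ker_le Ideal.Quotient.mk_surjective ?_
    rw [Ideal.mk_ker, Ideal.span_le, Set.singleton_subset_iff]
    exact evalL_G_mem_span_HS k 277 (Or.inr rfl)
  let P₀ : Spec (.of (MvPolynomial (Fin 5) k ⧸ Ideal.span {KLocCellKit.evalL k (G (277 : Fin 327))})) :=
    ⟨(Ideal.span {x | x ∈ HS.map (KLocCellKit.evalL k)}).map (Ideal.Quotient.mk (Ideal.span {KLocCellKit.evalL k (G (277 : Fin 327))})), hmax.isPrime⟩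
  have hP₀ : P₀.asIdeal = (Ideal.span {x | x ∈ HS.map (KLocCellKit.evalL k)}).map
      (Ideal.Quotient.mk (Ideal.span {KLocCellKit.evalL k (G (277 : Fin 327))})) := rfl
  -- `P` lies over `v`
  have hPx : (affineBlowup.π (𝔪 * K₁)).base (ι.base P₀) = v := by
    apply PrimeSpectrum.ext
    apply Ideal.comap_injective_of_surjective (Ideal.Quotient.mk (Ideal.span {f})) Ideal.Quotient.mk_surjective
    rw [hcompat P₀, hP₀, comap_span_HS]
    -- `(v)⁻¹ = (X₀,…,X₄)` as well
    refine (QuotientOriginMaximal.idealOfVars_isMaximal k (n := 5)).eq_of_le (Ideal.comap_isPrime _ _).ne_top ?_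
    rw [MvPolynomial.idealOfVars, Ideal.span_le]
    rintro _ ⟨j, rfl⟩
    rw [SetLike.mem_coe, Ideal.mem_comap, hv, h𝔪]
    exact Ideal.subset_span ⟨j, rfl⟩
  -- `P` is a closed point (Jacobson)
  have hP : IsClosed ({ι.base P₀} : Set ↥(affineBlowup (𝔪 * K₁))) :=
    isClosed_singleton_of_isOpenImmersion (affineBlowup.π (𝔪 * K₁)) ι P₀ ((PrimeSpectrum.isClosed_singleton_iff_isMaximal P₀).mpr hmax)
  -- the storey-2 ring `A = k[Y]/(G₃)`, its origin `Q`, and the coordinate change `σ`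
  haveI hpG : (Ideal.span {G₃}).IsPrime := FDStorey2Specimen.isPrime_span_f k G₃ hG₃
  haveI : IsDomain (MvPolynomial (Fin 5) k ⧸ Ideal.span {G₃}) := Ideal.Quotient.isDomain _
  have hQmax : (Ideal.span (Set.range (fun j : Fin 5 => Ideal.Quotient.mk (Ideal.span {G₃}) (X j)))).IsMaximal := by
    have heq : Ideal.span (Set.range (fun j : Fin 5 => Ideal.Quotient.mk (Ideal.span {G₃}) (X j))) =
        (MvPolynomial.idealOfVars (Fin 5) k).map (Ideal.Quotient.mk (Ideal.span {G₃})) := by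
      rw [MvPolynomial.idealOfVars, Ideal.map_span, ← Set.range_comp]
      rfl
    rw [heq]
    haveI := QuotientOriginMaximal.idealOfVars_isMaximal k (n := 5)
    refine Ideal.IsMaximal.map_of_surjective_of_ker_le Ideal.Quotient.mk_surjective ?_
    rw [Ideal.mk_ker, Ideal.span_le, Set.singleton_subset_iff, SetLike.mem_coe, QuotientOriginMaximal.mem_idealOfVars_iff]
    exact FDStorey2Specimen.constantCoeff_f k G₃ hG₃
  let Q : Spec (.of (MvPolynomial (Fin 5) k ⧸ Ideal.span {G₃})) := ⟨_, hQmax.isPrime⟩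
  have hQdef : Q.asIdeal = Ideal.span (Set.range (fun j : Fin 5 => Ideal.Quotient.mk (Ideal.span {G₃}) (X j))) := rfl
  obtain ⟨σ, -, hσP⟩ := FDStorey2ChartIso.exists_chartEquiv k G₃ hG₃
  have hQ : Q.asIdeal.comap σ.toRingHom = P₀.asIdeal := FDStorey2ChartIso.comap_chartEquiv_origin k G₃ σ hσP P₀ hP₀ Q hQdef
  -- the local storey-2 datum at `P`
  obtain ⟨𝔍, h𝔍, h𝔍supp, hfull₂⟩ := localSecondStorey_of_chartModel 2 ι σ P₀ Q hQ I hI (by rw [hQdef]; exact hIQ) hfull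
  -- storey 1 is FULL at every other point
  have hfull₁ : ∀ x₁ : ↥(affineBlowup (𝔪 * K₁)), x₁ ≠ ι.base P₀ → (affineBlowup.π (𝔪 * K₁)).base x₁ ⤳ v →
      FullCl 2 ((affineBlowup (𝔪 * K₁)).presheaf.stalk x₁) := fun x₁ hne _ => hoff P₀ hP₀ x₁ hne
  -- glue
  exact fHalfConclusion_of_localSecondStorey_affine 2 𝔪 K₁ h𝔪ne hK₁ v (by rw [hv]; exact Ideal.le_radical) (by rw [hv]; exact h𝔪K₁)
    (ι.base P₀) hPx hP 𝔍 h𝔍 h𝔍supp hfull₂ hfull₁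

/-! ## §3 The storey-2 inputs in the SUPPORT form (`Supp Ĩ = {origin}`, the letter of `…FDStorey2L1BlowupFull.support_idealSheaf_mK`) -/

/-- `Supp (Ĩ) = {w}` forces `w ⊆ √I` (the radical is the intersection of the primes over `I`, all equal to `w`). [folklore; cite: AtiyahMacdonald1969, Prop. 1.14] -/
theorem le_radical_of_support_eq_singleton {R : Type} [CommRing R] (I : Ideal R) (w : Spec (.of R))
    (h : ((affineBlowup.idealSheaf I).support : Set (Spec (.of R))) = {w}) : w.asIdeal ≤ I.radical := by
  rw [affineBlowup.support_idealSheaf] at h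
  rw [Ideal.radical_eq_sInf]
  refine le_sInf fun J hJ => ?_
  obtain ⟨hIJ, hJp⟩ := hJ
  have hmem : (⟨J, hJp⟩ : Spec (.of R)) ∈ PrimeSpectrum.zeroLocus (I : Set R) := fun r hr => hIJ hr
  rw [h] at hmem
  have hEq : (⟨J, hJp⟩ : Spec (.of R)) = w := hmem
  rw [← hEq]

/-- `Supp (Ĩ) = {w}` with `w ≠` the generic point forces `I ≠ ⊥` (in a domain `Supp (⊥̃)` is everything). [folklore] -/
theorem ne_bot_of_support_eq_singleton {R : Type} [CommRing R] [IsDomain R] (I : Ideal R) (w : Spec (.of R))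
    (h : ((affineBlowup.idealSheaf I).support : Set (Spec (.of R))) = {w}) (hw : w.asIdeal ≠ ⊥) : I ≠ ⊥ := by
  intro h0
  rw [affineBlowup.support_idealSheaf, h0] at h
  have hgen : (⟨⊥, Ideal.isPrime_bot⟩ : Spec (.of R)) ∈ PrimeSpectrum.zeroLocus (((⊥ : Ideal R) : Set R)) := fun r hr => hr
  rw [h] at hgen
  have hEq : (⟨⊥, Ideal.isPrime_bot⟩ : Spec (.of R)) = w := hgen
  exact hw (by rw [← hEq])

set_option maxHeartbeats 800000 in
-- large statement; several instance constructions on quotient rings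
/-- ★★★ **BED D, TWO STOREYS, ASSEMBLED — storey 2 in the SUPPORT letter** of res-L1-w45a-stub-3ʼs `…FDStorey2L1BlowupFull` (`support_idealSheaf_mK` : `Supp Ĩ = {origin}` for every
point `w` with `w = (Ȳⱼ)`, and `affineBlowup_mK_fullCl` : FULL at every point): `I ≠ ⊥` and `(Ȳⱼ) ⊆ √I` are derived here, then `twoStorey_fD_row_of`. [OURS · assembly] -/
theorem twoStorey_fD_row_of_support [CharP k 2] (f : MvPolynomial (Fin 5) k) (hf : f = X 4 ^ 4 + X 0 ^ 5 * X 4 + X 0 ^ 6 + X 1 ^ 3 + X 2 ^ 3 + X 3 ^ 7)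
    (𝔪 : Ideal (MvPolynomial (Fin 5) k ⧸ Ideal.span {f})) (h𝔪 : 𝔪 = Ideal.span (Set.range (fun j : Fin 5 => Ideal.Quotient.mk (Ideal.span {f}) (X j))))
    (v : Spec (.of (MvPolynomial (Fin 5) k ⧸ Ideal.span {f}))) (hv : v.asIdeal = 𝔪)
    (K₁ : Ideal (MvPolynomial (Fin 5) k ⧸ Ideal.span {f})) (hK₁ : K₁ ≠ ⊥) (h𝔪K₁ : 𝔪 ≤ K₁.radical)
    (ι : Spec (.of (MvPolynomial (Fin 5) k ⧸ Ideal.span {KLocCellKit.evalL k (G (277 : Fin 327))})) ⟶ affineBlowup (𝔪 * K₁))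
    [IsOpenImmersion ι]
    (hcompat : ∀ q : Spec (.of (MvPolynomial (Fin 5) k ⧸ Ideal.span {KLocCellKit.evalL k (G (277 : Fin 327))})),
      ((affineBlowup.π _).base (ι.base q)).asIdeal.comap (Ideal.Quotient.mk (Ideal.span {f})) =
        q.asIdeal.comap ((Ideal.Quotient.mk (Ideal.span {KLocCellKit.evalL k (G (277 : Fin 327))})).comp
          (aeval (fun j : Fin 5 => ∏ i : Fin 5, (X i : MvPolynomial (Fin 5) k) ^ Vq (277 : Fin 327) i j)).toRingHom))
    (hoff : ∀ P₀ : Spec (.of (MvPolynomial (Fin 5) k ⧸ Ideal.span {KLocCellKit.evalL k (G (277 : Fin 327))})),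
      P₀.asIdeal = (Ideal.span {x | x ∈ HS.map (KLocCellKit.evalL k)}).map (Ideal.Quotient.mk (Ideal.span {KLocCellKit.evalL k (G (277 : Fin 327))})) →
      ∀ y : ↥(affineBlowup (𝔪 * K₁)), y ≠ ι.base P₀ → FullCl 2 ((affineBlowup (𝔪 * K₁)).presheaf.stalk y))
    (G₃ : MvPolynomial (Fin 5) k) (hG₃ : G₃ = X 2 ^ 2 + X 0 ^ 3 + X 1 ^ 3 + X 3 * X 4 ^ 4 + X 3 ^ 2 * X 4 + X 2 * X 3 * X 4 ^ 4 + X 2 * X 3 ^ 2 * X 4)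
    (I : Ideal (MvPolynomial (Fin 5) k ⧸ Ideal.span {G₃}))
    (hIsupp : ∀ w : Spec (.of (MvPolynomial (Fin 5) k ⧸ Ideal.span {G₃})),
      w.asIdeal = Ideal.span (Set.range (fun j : Fin 5 => Ideal.Quotient.mk (Ideal.span {G₃}) (X j))) →
      ((affineBlowup.idealSheaf I).support : Set (Spec (.of (MvPolynomial (Fin 5) k ⧸ Ideal.span {G₃})))) = {w})
    (hfull : ∀ y : ↥(affineBlowup I), FullCl 2 ((affineBlowup I).presheaf.stalk y)) :
    ∀ (S' : Scheme.{0}) (g : S' ⟶ Spec ((Spec (.of (MvPolynomial (Fin 5) k ⧸ Ideal.span {f}))).presheaf.stalk v)),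
      IsBlowup g ((affineBlowup.idealSheaf 𝔪).comap ((Spec (.of (MvPolynomial (Fin 5) k ⧸ Ideal.span {f}))).fromSpecStalk v)) →
      ∃ 𝓚 : S'.IdealSheafData, 𝓚 ≠ ⊥ ∧
        (∀ s ∈ (𝓚.support : Set S'), g.base s = closedPoint ((Spec (.of (MvPolynomial (Fin 5) k ⧸ Ideal.span {f}))).presheaf.stalk v)) ∧
        ∀ (S'' : Scheme.{0}) (π : S'' ⟶ S'), IsBlowup π 𝓚 → ∀ s : S'', FullCl 2 (S''.presheaf.stalk s) := by
  classical
  -- the origin `Q` of `Spec k[Y]/(G₃)`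
  haveI hpG : (Ideal.span {G₃}).IsPrime := FDStorey2Specimen.isPrime_span_f k G₃ hG₃
  haveI : IsDomain (MvPolynomial (Fin 5) k ⧸ Ideal.span {G₃}) := Ideal.Quotient.isDomain _
  have hQmax : (Ideal.span (Set.range (fun j : Fin 5 => Ideal.Quotient.mk (Ideal.span {G₃}) (X j)))).IsMaximal := by
    have heq : Ideal.span (Set.range (fun j : Fin 5 => Ideal.Quotient.mk (Ideal.span {G₃}) (X j))) =
        (MvPolynomial.idealOfVars (Fin 5) k).map (Ideal.Quotient.mk (Ideal.span {G₃})) := by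
      rw [MvPolynomial.idealOfVars, Ideal.map_span, ← Set.range_comp]
      rfl
    rw [heq]
    haveI := QuotientOriginMaximal.idealOfVars_isMaximal k (n := 5)
    refine Ideal.IsMaximal.map_of_surjective_of_ker_le Ideal.Quotient.mk_surjective ?_
    rw [Ideal.mk_ker, Ideal.span_le, Set.singleton_subset_iff, SetLike.mem_coe, QuotientOriginMaximal.mem_idealOfVars_iff]
    exact FDStorey2Specimen.constantCoeff_f k G₃ hG₃
  let Q : Spec (.of (MvPolynomial (Fin 5) k ⧸ Ideal.span {G₃})) := ⟨_, hQmax.isPrime⟩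
  have hQdef : Q.asIdeal = Ideal.span (Set.range (fun j : Fin 5 => Ideal.Quotient.mk (Ideal.span {G₃}) (X j))) := rfl
  have hsupp := hIsupp Q hQdef
  have hQne : Q.asIdeal ≠ ⊥ := by
    intro h0
    have hmem : Ideal.Quotient.mk (Ideal.span {G₃}) (X 0) ∈ Q.asIdeal := by rw [hQdef]; exact Ideal.subset_span ⟨0, rfl⟩
    rw [h0, Ideal.mem_bot] at hmem
    exact FDStorey2Specimen.mk_X_ne_zero k G₃ hG₃ 0 hmem
  have hI : I ≠ ⊥ := ne_bot_of_support_eq_singleton I Q hsupp hQne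
  have hIQ : Ideal.span (Set.range (fun j : Fin 5 => Ideal.Quotient.mk (Ideal.span {G₃}) (X j))) ≤ I.radical := by
    rw [← hQdef]
    exact le_radical_of_support_eq_singleton I Q hsupp
  exact twoStorey_fD_row_of k f hf 𝔪 h𝔪 v hv K₁ hK₁ h𝔪K₁ ι hcompat hoff G₃ hG₃ I hI hIQ hfull

end Summit.ResolutionOfSingularities.ResolutionOfSingularities.Theorems.FInjectiveMacaulayfication.FDTwoStoreyRow

end
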